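import Summits.KontsevichZagierPeriods.KontsevichZagierPeriods.Theses.TwoRouteTransport
import Summits.KontsevichZagierPeriods.KontsevichZagierPeriods.Theorems.TerasomaMultiplicationGammaHodgeSectorStubBetaRelators
import Summits.KontsevichZagierPeriods.KontsevichZagierPeriods.Theorems.TerasomaMultiplicationTriplicationFromMultiplication
import Summits.KontsevichZagierPeriods.KontsevichZagierPeriods.Theorems.TerasomaMultiplicationBetaCancellationOfPiCancellation
import Literature.NumberTheory.Transcendental.KZBetaUnitExponent
import Literature.NumberTheory.Transcendental.KZGaussMultiplicationChain

/-!
# `TriplicationGlue` (stmt-KontsevichZagierPeriods-12075, route TwoRouteTransport) — proof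

`TriplicationGlue` is `CubicEndpoint → BetaCancellation → DuplicationFamily → TriplicationAccessible`:
the Gauss-triplication pair 0312, `r = [(0,1)², x^{-8/9}(1-x)^{-5/9}y^{-4/9}(1-y)^{-2/9}] ∼
r' = [{x²+y²<4}, 3^{7/6}/2]` (`T = B(1/9,4/9)B(5/9,7/9) = 2·3^{7/6}·π`), from the cubic endpoint
identity `E : β(7/18,1/9)β(2/9,1/9) ∼ (3/4)^{1/6} β(2/9,5/18)β(7/18,1/18)`, Legendre duplication
`D(a) : β(a,a) ∼ 2^{1-2a} β(1/2,a)` at `a = 1/18, 5/18`, and cancellation of Beta factors.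

Proof, entirely in the commutative formal period ring `P = FormalRep ⧸ relations`
(`β(p,q) = GammaHodgeSectorKO.betaClass p q`, `κ(c) = ⟦[pt, c]⟧`): the Γ-bookkeeping
`E × D(1/18) × D(5/18) ⟺ triplication at 1/9` becomes the PURE BETA identity
`T · e_R · d_R = 3 · β(½,½) · e_L · d_L` (`e_L, e_R` the two sides of `E` without constant,
`d_L = β(1/18,1/18)β(5/18,5/18)`, `d_R = β(1/2,1/18)β(1/2,5/18)`), which holds by SEVEN Dirichlet
re-associations `β(a,b)β(a+b,c) = β(b,c)β(a,b+c)` and reflections `β(a,b) = β(b,a)`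
(`GammaHodgeSectorKO.stub_betaRelators`) plus `β(1/3,1) = κ(3)` (`KZ.betaFirst_equivalent_unit_constMul`);
substituting `E`, `D(1/18)`, `D(5/18)` gives `⟦r⟧ · M = κ(2·3^{7/6}) ⟦π⟧ · M` with
`M = β(2/9,5/18)β(1/18,7/18)β(1/18,1/2)β(5/18,1/2)`, `BetaCancellation` makes `M` a non-zero-divisor of
`P`, and `κ(2·3^{7/6})⟦π⟧ = ⟦r'⟧` is the landed disc scaling `piRep_const_equiv_target`.
(lead c10 of crux 9129, banking)
-/

noncomputable section

namespace Summit.KontsevichZagierPeriods.TwoRouteTransport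

open MeasureTheory Set
open Literature.NumberTheory.Transcendental Literature.NumberTheory.Transcendental.KZ
open Summit.KontsevichZagierPeriods.GammaHodgeSectorKO (betaRep betaRep_domain betaRep_integrand
  betaClass betaClass_eq kap kap_mul kap_congr IsBetaRep stub_betaRelators)
open Summit.KontsevichZagierPeriods.KontsevichZagierPeriods.BetaCancellationNegative (betaKernel
  mem_unitIoo betaHalfRep equivalent_betaHalfRep_piRep)
open Literature.NumberTheory.Transcendental.KZreg (unitIoo)
open Summit.KontsevichZagierPeriods.KontsevichZagierPeriods.Theses.TwoRouteTransport
  (CubicEndpoint BetaCancellation DuplicationFamily TriplicationGlue)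
open Summit.KontsevichZagierPeriods.TerasomaMultiplication.TriplicationGlue (castAdd_one_zero
  natAdd_one_zero isAlgebraic_kappa piRep_const_equiv_target)
open Summit.KontsevichZagierPeriods.KontsevichZagierPeriods.BetaCancellationLine
  (betaRep_prod_betaRep_integrand)

/-! ## Beta representations and their classes -/

/-- The open unit interval of `ℝ¹` in the route's spelling. [folklore] -/
theorem unitIoo_eq_setOf : unitIoo = {x : Fin 1 → ℝ | x 0 ∈ Set.Ioo (0:ℝ) 1} :=
  Set.ext fun x => mem_unitIoo x

/-- `κ(q) · ⟦r⟧ = ⟦q · r⟧` in `P` (`KZ.toFormalPeriod_of_constMul`). [folklore] -/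
theorem kap_mul_toFormalPeriod {n : ℕ} (r : IntegralRep n) (q : ℝ) (hq : IsAlgebraic ℚ q) :
    kap q hq * toFormalPeriod (of r) = toFormalPeriod (of (r.constMul q hq)) :=
  (KZ.toFormalPeriod_of_constMul q hq r).symm

/-- The domain of a product of two Beta representations is the open box `(0,1)²`, in the `∀ i`
spelling of the route. [folklore] -/
theorem betaRep_prod_domain (a b a' b' : ℚ) (ha : 0 < a) (hb : 0 < b) (ha' : 0 < a')
    (hb' : 0 < b') :
    ((betaRep a b ha hb).prod (betaRep a' b' ha' hb')).domain =
      {z : Fin 2 → ℝ | ∀ i, z i ∈ Set.Ioo (0:ℝ) 1} := by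
  ext z
  simp only [IntegralRep.prod_domain, IntegralRep.mem_prodDomain, betaRep_domain, mem_unitIoo,
    mem_setOf_eq, Fin.forall_fin_two, castAdd_one_zero, natAdd_one_zero]

/-- **Beta classes are non-zero-divisors of `P`** under the route's `BetaCancellation`
(`[β] · c ∈ relations ⇒ c ∈ relations` for the Beta-shaped `β(a,b)`, `0 < a, b`). [folklore] -/
theorem betaClass_mem_nonZeroDivisors (hB : BetaCancellation) (a b : ℚ) (ha : 0 < a)
    (hb : 0 < b) : betaClass a b ∈ nonZeroDivisors FormalPeriodRing := by
  rw [betaClass_eq a b ha hb, mem_nonZeroDivisors_iff_left]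
  intro p hp
  obtain ⟨c, rfl⟩ := toFormalPeriod_surjective p
  rw [← map_mul, toFormalPeriod_eq_zero_iff] at hp
  refine toFormalPeriod_eq_zero_iff.mpr (hB (betaRep a b ha hb) ⟨1, a - 1, b - 1, one_ne_zero,
    by linarith, by linarith, unitIoo_eq_setOf, fun x _ => ?_⟩ c hp)
  simp only [betaRep_integrand, betaKernel]
  push_cast
  ring

/-! ## The pinned data of the item as identities in `P` -/

/-- The class of the 0312 representation: `⟦r⟧ = β(1/9,4/9) · β(5/9,7/9)` (same domain, integrands
agree on it: one rule-(1b) move against the Fubini product). [folklore] -/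
theorem toFormalPeriod_lhs (r : IntegralRep 2) (hrd : r.domain = {x | ∀ i, x i ∈ Set.Ioo (0:ℝ) 1})
    (hri : Set.EqOn r.integrand (fun x => (x 0) ^ (-(8:ℝ)/9) * (1 - x 0) ^ (-(5:ℝ)/9) *
      (x 1) ^ (-(4:ℝ)/9) * (1 - x 1) ^ (-(2:ℝ)/9)) r.domain) :
    toFormalPeriod (of r) = betaClass (1/9) (4/9) * betaClass (5/9) (7/9) := by
  have h19 : (0:ℚ) < 1/9 := by norm_num
  have h49 : (0:ℚ) < 4/9 := by norm_num
  have h59 : (0:ℚ) < 5/9 := by norm_num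
  have h79 : (0:ℚ) < 7/9 := by norm_num
  rw [betaClass_eq _ _ h19 h49, betaClass_eq _ _ h59 h79, toFormalPeriod_of_mul_of]
  refine Equivalent.toFormalPeriod_eq (of_sub_of_mem_relations_of_eqOn ?_ fun z hz => ?_)
  · rw [hrd]
    exact betaRep_prod_domain _ _ _ _ h19 h49 h59 h79
  · rw [hri hz]
    dsimp only
    rw [betaRep_prod_betaRep_integrand]
    simp only [betaKernel]
    have e1 : ((1/9:ℚ):ℝ) - 1 = -(8:ℝ)/9 := by norm_num
    have e2 : ((4/9:ℚ):ℝ) - 1 = -(5:ℝ)/9 := by norm_num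
    have e3 : ((5/9:ℚ):ℝ) - 1 = -(4:ℝ)/9 := by norm_num
    have e4 : ((7/9:ℚ):ℝ) - 1 = -(2:ℝ)/9 := by norm_num
    rw [e1, e2, e3, e4]
    ring

/-- **`CubicEndpoint` in `P`**: `β(7/18,1/9) · β(2/9,1/9) = κ((3/4)^{1/6}) · β(2/9,5/18) · β(7/18,1/18)`
(instantiate the crux at the two Fubini products, the second one scaled). [folklore] -/
theorem cubicEndpoint_betaClass (hE : CubicEndpoint) (hc : IsAlgebraic ℚ (((3:ℝ)/4) ^ ((1:ℝ)/6))) :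
    betaClass (7/18) (1/9) * betaClass (2/9) (1/9) =
      kap _ hc * (betaClass (2/9) (5/18) * betaClass (7/18) (1/18)) := by
  have h718 : (0:ℚ) < 7/18 := by norm_num
  have h19 : (0:ℚ) < 1/9 := by norm_num
  have h29 : (0:ℚ) < 2/9 := by norm_num
  have h518 : (0:ℚ) < 5/18 := by norm_num
  have h118 : (0:ℚ) < 1/18 := by norm_num
  rw [betaClass_eq _ _ h718 h19, betaClass_eq _ _ h29 h19, betaClass_eq _ _ h29 h518,
    betaClass_eq _ _ h718 h118, toFormalPeriod_of_mul_of, toFormalPeriod_of_mul_of,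
    kap_mul_toFormalPeriod]
  refine Equivalent.toFormalPeriod_eq (hE _ _ (betaRep_prod_domain _ _ _ _ h718 h19 h29 h19)
    (fun z _ => ?_) (betaRep_prod_domain _ _ _ _ h29 h518 h718 h118) (fun z _ => ?_))
  · rw [betaRep_prod_betaRep_integrand]
    simp only [betaKernel]
    have e1 : ((7/18:ℚ):ℝ) - 1 = -(11:ℝ)/18 := by norm_num
    have e2 : ((1/9:ℚ):ℝ) - 1 = -(8:ℝ)/9 := by norm_num
    have e3 : ((2/9:ℚ):ℝ) - 1 = -(7:ℝ)/9 := by norm_num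
    rw [e1, e2, e3]
    ring
  · simp only [IntegralRep.integrand_constMul, betaRep_prod_betaRep_integrand, betaKernel]
    have e3 : ((2/9:ℚ):ℝ) - 1 = -(7:ℝ)/9 := by norm_num
    have e4 : ((5/18:ℚ):ℝ) - 1 = -(13:ℝ)/18 := by norm_num
    have e5 : ((7/18:ℚ):ℝ) - 1 = -(11:ℝ)/18 := by norm_num
    have e6 : ((1/18:ℚ):ℝ) - 1 = -(17:ℝ)/18 := by norm_num
    rw [e3, e4, e5, e6]
    ring

/-- **`DuplicationFamily` in `P`**: `β(a,a) = κ(2^{1-2a}) · β(1/2,a)` for rational `a > 0`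
(instantiate at `β(a,a)` — `t^{a-1}(1-t)^{a-1} = (t(1-t))^{a-1}` on `(0,1)` — and at the scaled
`β(1/2,a)`). [folklore] -/
theorem duplication_betaClass (hD : DuplicationFamily) (a : ℚ) (ha : 0 < a)
    (h2 : IsAlgebraic ℚ ((2:ℝ) ^ (1 - 2 * (a:ℝ)))) :
    betaClass a a = kap _ h2 * betaClass (1/2) a := by
  have hh : (0:ℚ) < 1/2 := by norm_num
  rw [betaClass_eq a a ha ha, betaClass_eq _ a hh ha, kap_mul_toFormalPeriod]
  refine Equivalent.toFormalPeriod_eq (hD a ha _ _ unitIoo_eq_setOf (fun x hx => ?_)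
    unitIoo_eq_setOf (fun x _ => ?_))
  · have hx' : x 0 ∈ Set.Ioo (0:ℝ) 1 := (mem_unitIoo x).1 hx
    simp only [betaRep_integrand, betaKernel]
    rw [Real.mul_rpow hx'.1.le (sub_nonneg.2 hx'.2.le)]
  · simp only [IntegralRep.integrand_constMul, betaRep_integrand, betaKernel]
    rw [show ((1/2:ℚ):ℝ) - 1 = -(1:ℝ)/2 by norm_num]
    ring

/-- **`β(1/3, 1) = κ(3)`**: `[(0,1), t^{-2/3}] ∼ [pt, 3]` (`KZ.betaFirst_equivalent_unit_constMul`,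
one Newton–Leibniz move over the point). [folklore] -/
theorem betaClass_third_one (h3 : IsAlgebraic ℚ (3:ℝ)) : betaClass (1/3) 1 = kap 3 h3 := by
  have h13 : (0:ℚ) < 1/3 := by norm_num
  have hinv : IsAlgebraic ℚ (((1/3:ℚ):ℝ)⁻¹) := (isAlgebraic_algebraMap (1/3:ℚ)).inv
  rw [betaClass_eq _ _ h13 one_pos, (KZ.betaFirst_equivalent_unit_constMul (1/3) h13
    (betaRep (1/3) 1 h13 one_pos) unitIoo_eq_setOf (fun _ _ => rfl) hinv).toFormalPeriod_eq]
  exact kap_congr hinv h3 (by norm_num)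

/-- **`β(1/2, 1/2) = ⟦π⟧`** (`equivalent_betaHalfRep_piRep`: `[β(½,½)] ∼ [closed unit disc, 1]`).
[folklore] -/
theorem betaClass_half_half : betaClass (1/2) (1/2) = toFormalPeriod (of piRep) := by
  have hhalf : IsBetaRep (1/2) (1/2) betaHalfRep := ⟨rfl, fun _ _ => rfl⟩
  rw [← hhalf.toFormalPeriod_eq (by norm_num) (by norm_num)]
  exact equivalent_betaHalfRep_piRep.toFormalPeriod_eq

/-- **Dirichlet re-association** with the two sums substituted:
`β(a,b) · β(a+b,c) = β(b,c) · β(a,b+c)` (`stub_betaRelators`). [folklore] -/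
theorem dirichlet_betaClass {a b c d e : ℚ} (ha : 0 < a) (hb : 0 < b) (hc : 0 < c)
    (hd : a + b = d) (he : b + c = e) :
    betaClass a b * betaClass d c = betaClass b c * betaClass a e := by
  subst hd he
  exact stub_betaRelators.2.2.2.1 a b c ha hb hc

/-! ## Constants -/

/-- `(3/4)^{1/6}` is algebraic (its sixth power is `3/4`). [folklore] -/
theorem isAlgebraic_cubicConst : IsAlgebraic ℚ (((3:ℝ)/4) ^ ((1:ℝ)/6)) := by
  refine IsAlgebraic.of_pow (by norm_num : 0 < 6) ?_
  rw [← Real.rpow_natCast, ← Real.rpow_mul (by norm_num : (0:ℝ) ≤ 3/4)]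
  norm_num
  have h : IsAlgebraic ℚ (((3/4:ℚ)):ℝ) := isAlgebraic_algebraMap _
  push_cast at h
  exact h

/-- `2^{1-2a}` is algebraic for rational `a`. [folklore] -/
theorem isAlgebraic_dupConst (a : ℚ) : IsAlgebraic ℚ ((2:ℝ) ^ (1 - 2 * (a:ℝ))) := by
  have h := KZ.isAlgebraic_natCast_rpow_ratCast 2 (1 - 2 * a)
  push_cast at h
  exact h

/-- **The constant**: `3 · (3/4)^{1/6} · 2^{1-1/9} · 2^{1-5/9} = 2 · 3^{7/6}`. [folklore] -/
theorem const_identity :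
    3 * ((3:ℝ)/4) ^ ((1:ℝ)/6) * (2:ℝ) ^ (1 - 2 * ((1/18:ℚ):ℝ)) * (2:ℝ) ^ (1 - 2 * ((5/18:ℚ):ℝ)) =
      2 * (3:ℝ) ^ ((7:ℝ)/6) := by
  have h2 : (0:ℝ) < 2 := by norm_num
  have h3 : (0:ℝ) < 3 := by norm_num
  have e1 : (1 - 2 * ((1/18:ℚ):ℝ)) = (8:ℝ)/9 := by norm_num
  have e2 : (1 - 2 * ((5/18:ℚ):ℝ)) = (4:ℝ)/9 := by norm_num
  have e4 : ((3:ℝ)/4) ^ ((1:ℝ)/6) = (3:ℝ) ^ ((1:ℝ)/6) / (2:ℝ) ^ ((1:ℝ)/3) := by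
    rw [Real.div_rpow h3.le (by norm_num), show (4:ℝ) = (2:ℝ) ^ (2:ℝ) by rw [Real.rpow_two]; norm_num,
      ← Real.rpow_mul h2.le]
    norm_num
  have e5 : (3:ℝ) ^ ((7:ℝ)/6) = 3 * (3:ℝ) ^ ((1:ℝ)/6) := by
    rw [show (7:ℝ)/6 = 1 + 1/6 by norm_num, Real.rpow_add h3, Real.rpow_one]
  have e6 : (2:ℝ) ^ ((8:ℝ)/9) * (2:ℝ) ^ ((4:ℝ)/9) = 2 * (2:ℝ) ^ ((1:ℝ)/3) := by
    rw [← Real.rpow_add h2, show (8:ℝ)/9 + 4/9 = 1 + 1/3 by norm_num, Real.rpow_add h2,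
      Real.rpow_one]
  have hpos : (0:ℝ) < (2:ℝ) ^ ((1:ℝ)/3) := Real.rpow_pos_of_pos h2 _
  rw [e1, e2, e4, e5, show 3 * ((3:ℝ) ^ ((1:ℝ)/6) / (2:ℝ) ^ ((1:ℝ)/3)) * (2:ℝ) ^ ((8:ℝ)/9) *
      (2:ℝ) ^ ((4:ℝ)/9) = 3 * (3:ℝ) ^ ((1:ℝ)/6) * ((2:ℝ) ^ ((8:ℝ)/9) * (2:ℝ) ^ ((4:ℝ)/9)) /
      (2:ℝ) ^ ((1:ℝ)/3) by ring, e6]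
  field_simp

/-! ## The theorem -/

/-- **`TriplicationGlue`** (route TwoRouteTransport, stmt-KontsevichZagierPeriods-12075):
`CubicEndpoint → BetaCancellation → DuplicationFamily → TriplicationAccessible`, i.e.
`B(1/9,4/9)B(5/9,7/9) = 2·3^{7/6}π` INSIDE the rules from the cubic endpoint identity, Legendre
duplication at `1/18` and `5/18`, and cancellation of Beta factors. In the formal period ring: seven
Dirichlet re-associations and reflections plus `β(1/3,1) = κ(3)` give
`β(1/9,4/9)β(5/9,7/9)·e_R·d_R = κ(3)β(½,½)·e_L·d_L`; substitute `E`, `D(1/18)`, `D(5/18)`, cancel the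
four Beta factors (`BetaCancellation`), and finish with `[β(½,½)] ∼ [π]` and the disc scaling
`κ(2·3^{7/6})⟦π⟧ = ⟦[disc of radius 2, 3^{7/6}/2]⟧`. [folklore] -/
theorem triplicationGlue_proof : TriplicationGlue := by
  intro hE hB hD r r' hrd hri hr'd hr'i
  -- reflections and Dirichlet re-associations in `P`
  have S : ∀ a b : ℚ, 0 < a → 0 < b → betaClass a b = betaClass b a := stub_betaRelators.1
  have R1 : betaClass (2/9) (5/18) * betaClass (5/18) (1/2) =
      betaClass (5/18) (5/18) * betaClass (2/9) (5/9) := by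
    rw [S (5/18) (1/2) (by norm_num) (by norm_num)]
    exact dirichlet_betaClass (by norm_num) (by norm_num) (by norm_num) (by norm_num) (by norm_num)
  have R2 : betaClass (1/18) (7/18) * betaClass (1/9) (4/9) =
      betaClass (1/9) (7/18) * betaClass (1/18) (1/2) := by
    rw [S (1/9) (4/9) (by norm_num) (by norm_num), S (1/9) (7/18) (by norm_num) (by norm_num)]
    exact dirichlet_betaClass (by norm_num) (by norm_num) (by norm_num) (by norm_num) (by norm_num)
  have R3 : betaClass (1/18) (1/2) * betaClass (2/9) (5/9) =
      betaClass (1/18) (2/9) * betaClass (5/18) (1/2) := by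
    rw [S (1/18) (1/2) (by norm_num) (by norm_num), S (2/9) (5/9) (by norm_num) (by norm_num),
      S (5/18) (1/2) (by norm_num) (by norm_num)]
    exact dirichlet_betaClass (by norm_num) (by norm_num) (by norm_num) (by norm_num) (by norm_num)
  have R4 : betaClass (5/18) (1/2) * betaClass (5/9) (7/9) =
      betaClass (1/2) (5/9) * betaClass (5/18) (19/18) := by
    rw [S (5/9) (7/9) (by norm_num) (by norm_num)]
    exact dirichlet_betaClass (by norm_num) (by norm_num) (by norm_num) (by norm_num) (by norm_num)
  have R5 : betaClass (1/18) (1/2) * betaClass (1/2) (5/9) =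
      betaClass (1/2) (1/2) * betaClass (1/18) 1 := by
    rw [S (1/2) (5/9) (by norm_num) (by norm_num)]
    exact dirichlet_betaClass (by norm_num) (by norm_num) (by norm_num) (by norm_num) (by norm_num)
  have R6 : betaClass (1/18) 1 * betaClass (5/18) (19/18) =
      betaClass (1/18) (5/18) * betaClass (1/3) 1 := by
    rw [S (1/18) 1 (by norm_num) (by norm_num), S (5/18) (19/18) (by norm_num) (by norm_num),
      S (1/3) 1 (by norm_num) (by norm_num)]
    exact dirichlet_betaClass (by norm_num) (by norm_num) (by norm_num) (by norm_num) (by norm_num)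
  have R7 : betaClass (1/18) (2/9) * betaClass (1/18) (5/18) =
      betaClass (1/18) (1/18) * betaClass (1/9) (2/9) := by
    rw [S (1/18) (2/9) (by norm_num) (by norm_num), S (1/18) (5/18) (by norm_num) (by norm_num),
      S (1/9) (2/9) (by norm_num) (by norm_num)]
    exact dirichlet_betaClass (by norm_num) (by norm_num) (by norm_num) (by norm_num) (by norm_num)
  -- the three hypotheses, `β(1/3,1) = κ(3)` and `β(½,½) = ⟦π⟧` in `P`
  have h3 : IsAlgebraic ℚ (3:ℝ) := isAlgebraic_nat 3
  have hE' := cubicEndpoint_betaClass hE isAlgebraic_cubicConst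
  rw [S (7/18) (1/9) (by norm_num) (by norm_num), S (2/9) (1/9) (by norm_num) (by norm_num),
    S (7/18) (1/18) (by norm_num) (by norm_num)] at hE'
  have hD1 := duplication_betaClass hD (1/18) (by norm_num) (isAlgebraic_dupConst (1/18))
  rw [S (1/2) (1/18) (by norm_num) (by norm_num)] at hD1
  have hD2 := duplication_betaClass hD (5/18) (by norm_num) (isAlgebraic_dupConst (5/18))
  rw [S (1/2) (5/18) (by norm_num) (by norm_num)] at hD2
  rw [hD2] at R1
  rw [betaClass_half_half] at R5
  rw [betaClass_third_one h3] at R6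
  rw [hD1] at R7
  -- the pure-Beta identity, multiplied out: `⟦r⟧ · M = κ(3)κ((3/4)^{1/6})κ(2^{8/9})κ(2^{4/9})⟦π⟧ · M`
  have key : toFormalPeriod (of r) * (betaClass (2/9) (5/18) * betaClass (1/18) (7/18) *
      betaClass (1/18) (1/2) * betaClass (5/18) (1/2)) =
      kap 3 h3 * kap _ isAlgebraic_cubicConst * kap _ (isAlgebraic_dupConst (1/18)) *
        kap _ (isAlgebraic_dupConst (5/18)) * toFormalPeriod (of piRep) *
      (betaClass (2/9) (5/18) * betaClass (1/18) (7/18) * betaClass (1/18) (1/2) *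
        betaClass (5/18) (1/2)) := by
    rw [toFormalPeriod_lhs r hrd hri]
    linear_combination
      (betaClass (1/9) (4/9) * betaClass (5/9) (7/9) * betaClass (1/18) (7/18) *
        betaClass (1/18) (1/2)) * R1 +
      (betaClass (5/9) (7/9) * betaClass (1/18) (1/2) * kap _ (isAlgebraic_dupConst (5/18)) *
        betaClass (5/18) (1/2) * betaClass (2/9) (5/9)) * R2 +
      (betaClass (5/9) (7/9) * kap _ (isAlgebraic_dupConst (5/18)) * betaClass (5/18) (1/2) *
        betaClass (1/9) (7/18) * betaClass (1/18) (1/2)) * R3 +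
      (kap _ (isAlgebraic_dupConst (5/18)) * betaClass (5/18) (1/2) * betaClass (1/9) (7/18) *
        betaClass (1/18) (1/2) * betaClass (1/18) (2/9)) * R4 +
      (kap _ (isAlgebraic_dupConst (5/18)) * betaClass (5/18) (1/2) * betaClass (1/9) (7/18) *
        betaClass (1/18) (2/9) * betaClass (5/18) (19/18)) * R5 +
      (kap _ (isAlgebraic_dupConst (5/18)) * betaClass (5/18) (1/2) * betaClass (1/9) (7/18) *
        betaClass (1/18) (2/9) * toFormalPeriod (of piRep)) * R6 +
      (kap _ (isAlgebraic_dupConst (5/18)) * betaClass (5/18) (1/2) * betaClass (1/9) (7/18) *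
        toFormalPeriod (of piRep) * kap 3 h3) * R7 +
      (kap _ (isAlgebraic_dupConst (5/18)) * betaClass (5/18) (1/2) * toFormalPeriod (of piRep) *
        kap 3 h3 * kap _ (isAlgebraic_dupConst (1/18)) * betaClass (1/18) (1/2)) * hE'
  -- cancel the four Beta factors
  have hM : betaClass (2/9) (5/18) * betaClass (1/18) (7/18) * betaClass (1/18) (1/2) *
      betaClass (5/18) (1/2) ∈ nonZeroDivisors FormalPeriodRing :=
    mul_mem (mul_mem (mul_mem
      (betaClass_mem_nonZeroDivisors hB _ _ (by norm_num) (by norm_num))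
      (betaClass_mem_nonZeroDivisors hB _ _ (by norm_num) (by norm_num)))
      (betaClass_mem_nonZeroDivisors hB _ _ (by norm_num) (by norm_num)))
      (betaClass_mem_nonZeroDivisors hB _ _ (by norm_num) (by norm_num))
  rw [mul_cancel_right_mem_nonZeroDivisors hM, ← kap_mul, ← kap_mul, ← kap_mul,
    kap_congr _ isAlgebraic_kappa const_identity, kap_mul_toFormalPeriod] at key
  -- the target pair
  exact toFormalPeriod_eq_iff.mp
    (key.trans (piRep_const_equiv_target isAlgebraic_kappa r' hr'd hr'i).toFormalPeriod_eq)

end Summit.KontsevichZagierPeriods.TwoRouteTransport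

end
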